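import Literature.Analysis.Potential.LogEnergyKernels
import HarnessLib

/-!
# Logarithmic energy vs. the diagonal `H^{1/2}` energy, II: Fubini and the weight in closed form

Topic `Analysis/Potential`; second of three files (see `LogEnergyKernels.lean` for the statement and
the strategy). PROVED here, for a bounded measurable `ψ` (`|ψ| ≤ C`):

* the slice integrals `∫_q F((x,y),q) = 1_{(-R,R)²}(x,y) · (∫_x^y ψ)²/(y-x)²` and
  `∫_p F(p,(s,t)) = ψ(s)ψ(t) w_R(s,t)`;
* **integrability of `F` on `ℝ² × ℝ²`** (`integrable_quadF`: each slice is a product of two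
  integrable one-variable functions, and `∫_q |F| ≤ C²` on the box since `|∫_x^y ψ| ≤ C|y-x|`), hence
  **Fubini** `∬_{(-R,R)²} (∫_x^y ψ)²/(y-x)² = ∫ ψ(s)ψ(t) w_R(s,t)` (`setIntegral_sqBox_slopeSq`);
* the section `V_q` as the union of the rectangles `(-R,m)×(M,R)` and `(M,R)×(-R,m)` and the
  **closed form** `w_R(s,t) = 2(log(M+R) + log(R-m) - log 2R - log(M-m))` for `m = min s t < M = max s t`
  inside `(-R, R)` (`quadW_eq`).

## References

* A. M. Vershik, S. V. Kerov, Funct. Anal. Appl. 19 (1985) 21–31, Lemmas 2–3. [VershikKerov1985]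
* S. Mkrtchyan, Europ. J. Combin. 33 (2012), arXiv:1008.3854, Prop. 4.1. [Mkrtchyan2012]

## Mathlib

`MeasureTheory.integrable_prod_iff`, `integral_prod_mul`, `Integrable.mul_prod`,
`integral_integral_swap`, `setIntegral_prod`, `setIntegral_union`, `IntegrableOn.of_bound`,
`Measure.volume_eq_prod`, `Real.volume_Ioo`.
-/

noncomputable section

open MeasureTheory Set Filter intervalIntegral
open scoped Real Interval ENNReal

namespace Literature.Analysis.Potential

namespace LogEnergy

open Function

variable {ψ : ℝ → ℝ} {C R : ℝ}

/-! ### Inner integrals -/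

/-- The diagonal functional's integrand `Φ(p) = (∫_{p.1}^{p.2} ψ)² / (p.2 - p.1)²`. [folklore] -/
def slopeSq (ψ : ℝ → ℝ) (p : ℝ × ℝ) : ℝ := (∫ t in p.1..p.2, ψ t) ^ 2 / (p.2 - p.1) ^ 2

/-- `∫ 1_{I(p)} ψ = ∫_{min}^{max} ψ`. [folklore] -/
theorem integral_indicator_btwI (ψ : ℝ → ℝ) (p : ℝ × ℝ) :
    ∫ t, (btwI p).indicator ψ t = ∫ t in (min p.1 p.2)..(max p.1 p.2), ψ t := by
  rw [btwI, MeasureTheory.integral_indicator measurableSet_Ioo, intervalIntegral.integral_of_le min_le_max,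
    integral_Ioc_eq_integral_Ioo]

/-- `(∫_{min(x,y)}^{max(x,y)} ψ)² = (∫_x^y ψ)²`. [folklore] -/
theorem sq_integral_min_max (ψ : ℝ → ℝ) (p : ℝ × ℝ) :
    (∫ t in (min p.1 p.2)..(max p.1 p.2), ψ t) ^ 2 = (∫ t in p.1..p.2, ψ t) ^ 2 := by
  rcases le_total p.1 p.2 with h | h
  · rw [min_eq_left h, max_eq_right h]
  · rw [min_eq_right h, max_eq_left h, intervalIntegral.integral_symm, neg_sq]

/-- `∫_q F(p, q) = 1_{(-R,R)²}(p) Φ(p)`. [folklore] -/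
theorem integral_quadF_left (ψ : ℝ → ℝ) (R : ℝ) (p : ℝ × ℝ) :
    ∫ q, quadF ψ R (p, q) = (sqBox R).indicator (slopeSq ψ) p := by
  simp_rw [quadF_apply_left]
  rw [MeasureTheory.integral_const_mul, Measure.volume_eq_prod, integral_prod_mul, integral_indicator_btwI,
    ← sq, sq_integral_min_max]
  by_cases hp : p ∈ sqBox R
  · rw [indicator_of_mem hp, indicator_of_mem hp, slopeSq, div_eq_inv_mul]
  · rw [indicator_of_notMem hp, indicator_of_notMem hp, zero_mul]

/-- The weight `w_R(q) = ∫_p 1_{V_q}(p) / (y - x)²`. [folklore] -/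
def quadW (R : ℝ) (q : ℝ × ℝ) : ℝ := ∫ p, (quadV R q).indicator (fun p => ((p.2 - p.1) ^ 2)⁻¹) p

/-- `∫_p F(p, q) = ψ(s) ψ(t) w_R(s, t)`. [folklore] -/
theorem integral_quadF_right (ψ : ℝ → ℝ) (R : ℝ) (q : ℝ × ℝ) :
    ∫ p, quadF ψ R (p, q) = ψ q.1 * ψ q.2 * quadW R q := by
  simp_rw [quadF_apply_right]
  rw [MeasureTheory.integral_const_mul]
  rfl

/-! ### Integrability of the four-variable integrand -/

/-- `1_{I(p)} ψ` is integrable for bounded measurable `ψ`. [folklore] -/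
theorem integrable_indicator_btwI (hψm : Measurable ψ) (hψb : ∀ t, |ψ t| ≤ C) (p : ℝ × ℝ) :
    Integrable ((btwI p).indicator ψ) := by
  rw [btwI, integrable_indicator_iff measurableSet_Ioo]
  refine IntegrableOn.of_bound (by rw [Real.volume_Ioo]; exact ENNReal.ofReal_lt_top)
    hψm.aestronglyMeasurable C (Eventually.of_forall fun t => ?_)
  rw [Real.norm_eq_abs]
  exact hψb t

/-- Each `q`-slice of `F` is integrable. [folklore] -/
theorem integrable_quadF_left (hψm : Measurable ψ) (hψb : ∀ t, |ψ t| ≤ C) (R : ℝ) (p : ℝ × ℝ) :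
    Integrable fun q => quadF ψ R (p, q) := by
  simp_rw [quadF_apply_left]
  refine Integrable.const_mul ?_ _
  rw [Measure.volume_eq_prod]
  exact (integrable_indicator_btwI hψm hψb p).mul_prod (integrable_indicator_btwI hψm hψb p)

/-- `∫ |1_{I(p)} ψ| ≤ C |y - x|`. [folklore] -/
theorem integral_abs_indicator_btwI_le (hψb : ∀ t, |ψ t| ≤ C) (p : ℝ × ℝ) :
    ∫ t, |(btwI p).indicator ψ t| ≤ C * |p.2 - p.1| := by
  have hC : 0 ≤ C := (abs_nonneg _).trans (hψb 0)
  have h1 : (fun t => |(btwI p).indicator ψ t|) = (btwI p).indicator fun t => |ψ t| := by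
    ext t
    by_cases ht : t ∈ btwI p
    · rw [indicator_of_mem ht, indicator_of_mem ht]
    · rw [indicator_of_notMem ht, indicator_of_notMem ht, abs_zero]
  rw [h1, btwI, MeasureTheory.integral_indicator measurableSet_Ioo]
  have h2 := norm_setIntegral_le_of_norm_le_const (μ := volume) (s := btwI p) (f := fun t => |ψ t|)
    (C := C) (by rw [btwI, Real.volume_Ioo]; exact ENNReal.ofReal_lt_top)
    fun t _ => by rw [Real.norm_eq_abs, abs_abs]; exact hψb t
  rw [Real.norm_eq_abs, btwI, Real.volume_real_Ioo] at h2
  have h3 : max (max p.1 p.2 - min p.1 p.2) 0 = |p.2 - p.1| := by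
    rw [max_eq_left (sub_nonneg.mpr min_le_max)]
    rcases le_total p.1 p.2 with h | h
    · rw [min_eq_left h, max_eq_right h, abs_of_nonneg (sub_nonneg.mpr h)]
    · rw [min_eq_right h, max_eq_left h, abs_of_nonpos (sub_nonpos.mpr h), neg_sub]
  rw [h3] at h2
  exact (le_abs_self _).trans h2

/-- `∫_q |F(p,q)| ≤ C² 1_{(-R,R)²}(p)` (the slope of `g` is at most `C`). [folklore] -/
theorem integral_norm_quadF_left_le (hψb : ∀ t, |ψ t| ≤ C) (R : ℝ) (p : ℝ × ℝ) :
    ∫ q, ‖quadF ψ R (p, q)‖ ≤ C ^ 2 * (sqBox R).indicator 1 p := by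
  have hC : 0 ≤ C := (abs_nonneg _).trans (hψb 0)
  have h1 : (fun q : ℝ × ℝ => ‖quadF ψ R (p, q)‖) = fun q =>
      (sqBox R).indicator (fun p => ((p.2 - p.1) ^ 2)⁻¹) p *
        (|(btwI p).indicator ψ q.1| * |(btwI p).indicator ψ q.2|) := by
    ext q
    rw [quadF_apply_left, Real.norm_eq_abs, abs_mul, abs_mul,
      abs_of_nonneg (indicator_nonneg (fun p _ => by positivity) p)]
  have h4 := integral_prod_mul (μ := (volume : Measure ℝ)) (ν := (volume : Measure ℝ))
    (fun x => |(btwI p).indicator ψ x|) (fun x => |(btwI p).indicator ψ x|)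
  beta_reduce at h4
  rw [h1, MeasureTheory.integral_const_mul, Measure.volume_eq_prod, h4]
  by_cases hp : p ∈ sqBox R
  · rw [indicator_of_mem hp, indicator_of_mem hp, Pi.one_apply, mul_one]
    have h2 := integral_abs_indicator_btwI_le hψb p
    have h3 : 0 ≤ ∫ t, |(btwI p).indicator ψ t| := integral_nonneg fun t => abs_nonneg _
    by_cases hxy : p.2 - p.1 = 0
    · rw [hxy]; simp; positivity
    · calc ((p.2 - p.1) ^ 2)⁻¹ * ((∫ t, |(btwI p).indicator ψ t|) * ∫ t, |(btwI p).indicator ψ t|)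
          ≤ ((p.2 - p.1) ^ 2)⁻¹ * ((C * |p.2 - p.1|) * (C * |p.2 - p.1|)) := by
            gcongr
        _ = C ^ 2 := by
            have : |p.2 - p.1| ^ 2 = (p.2 - p.1) ^ 2 := sq_abs _
            field_simp
            nlinarith [this]
  · rw [indicator_of_notMem hp, indicator_of_notMem hp, zero_mul, mul_zero]

/-- **The four-variable integrand is integrable.** [folklore] -/
theorem integrable_quadF (hψm : Measurable ψ) (hψb : ∀ t, |ψ t| ≤ C) (R : ℝ) :
    Integrable (quadF ψ R) := by
  rw [Measure.volume_eq_prod,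
    integrable_prod_iff (measurable_quadF hψm R).aestronglyMeasurable]
  refine ⟨Eventually.of_forall fun p => integrable_quadF_left hψm hψb R p, ?_⟩
  have hmeas : AEStronglyMeasurable (fun p : ℝ × ℝ => ∫ q, ‖quadF ψ R (p, q)‖) volume :=
    (measurable_quadF hψm R).aestronglyMeasurable.norm.integral_prod_right'
  have hbound : Integrable (fun p : ℝ × ℝ => C ^ 2 * (sqBox R).indicator (1 : ℝ × ℝ → ℝ) p) := by
    refine Integrable.const_mul ?_ _
    rw [integrable_indicator_iff (measurableSet_sqBox R)]
    refine integrableOn_const ?_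
    rw [sqBox, Measure.volume_eq_prod, Measure.prod_prod, Real.volume_Ioo]
    exact ENNReal.mul_ne_top ENNReal.ofReal_ne_top ENNReal.ofReal_ne_top
  refine hbound.mono' hmeas (Eventually.of_forall fun p => ?_)
  rw [Real.norm_eq_abs, abs_of_nonneg (integral_nonneg fun q => norm_nonneg _)]
  exact integral_norm_quadF_left_le hψb R p

/-- **Fubini**: `∫_{(-R,R)²} Φ = ∫ ψ(s) ψ(t) w_R(s,t) d(s,t)`. [folklore] -/
theorem setIntegral_sqBox_slopeSq (hψm : Measurable ψ) (hψb : ∀ t, |ψ t| ≤ C) (R : ℝ) :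
    ∫ p in sqBox R, slopeSq ψ p = ∫ q, ψ q.1 * ψ q.2 * quadW R q := by
  rw [← MeasureTheory.integral_indicator (measurableSet_sqBox R)]
  simp_rw [← integral_quadF_left ψ R, ← integral_quadF_right ψ R]
  exact integral_integral_swap (integrable_quadF hψm hψb R)


/-! ### The weight `w_R` in closed form -/

/-- For `q = (s,t)` with `m = min s t < M = max s t`, `-R < m`, `M < R`: the section `V_q` is the
union of the two rectangles `(-R, m) × (M, R)` and `(M, R) × (-R, m)`. [folklore] -/
theorem quadV_eq_union (R : ℝ) (q : ℝ × ℝ) :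
    quadV R q = Ioo (-R) (min q.1 q.2) ×ˢ Ioo (max q.1 q.2) R ∪
      Ioo (max q.1 q.2) R ×ˢ Ioo (-R) (min q.1 q.2) := by
  ext ⟨x, y⟩
  simp only [quadV, sqBox, Sbtw, mem_setOf_eq, mem_prod, mem_Ioo, mem_union]
  constructor
  · rintro ⟨⟨⟨hx1, hx2⟩, hy1, hy2⟩, ⟨hs1, hs2⟩, ht1, ht2⟩
    rcases le_total x y with hxy | hxy
    · rw [min_eq_left hxy] at hs1 ht1
      rw [max_eq_right hxy] at hs2 ht2
      exact Or.inl ⟨⟨hx1, lt_min hs1 ht1⟩, max_lt hs2 ht2, hy2⟩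
    · rw [min_eq_right hxy] at hs1 ht1
      rw [max_eq_left hxy] at hs2 ht2
      exact Or.inr ⟨⟨max_lt hs2 ht2, hx2⟩, hy1, lt_min hs1 ht1⟩
  · have hmM : min q.1 q.2 ≤ max q.1 q.2 := min_le_max
    rintro (⟨⟨hx1, hx2⟩, hy1, hy2⟩ | ⟨⟨hx1, hx2⟩, hy1, hy2⟩)
    · have hxy : x ≤ y := by linarith
      refine ⟨⟨⟨hx1, by linarith⟩, by linarith, hy2⟩, ?_, ?_⟩
      · rw [min_eq_left hxy, max_eq_right hxy]
        exact ⟨lt_of_lt_of_le hx2 (min_le_left _ _), lt_of_le_of_lt (le_max_left _ _) hy1⟩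
      · rw [min_eq_left hxy, max_eq_right hxy]
        exact ⟨lt_of_lt_of_le hx2 (min_le_right _ _), lt_of_le_of_lt (le_max_right _ _) hy1⟩
    · have hxy : y ≤ x := by linarith
      refine ⟨⟨⟨by linarith, hx2⟩, hy1, by linarith⟩, ?_, ?_⟩
      · rw [min_eq_right hxy, max_eq_left hxy]
        exact ⟨lt_of_lt_of_le hy2 (min_le_left _ _), lt_of_le_of_lt (le_max_left _ _) hx1⟩
      · rw [min_eq_right hxy, max_eq_left hxy]
        exact ⟨lt_of_lt_of_le hy2 (min_le_right _ _), lt_of_le_of_lt (le_max_right _ _) hx1⟩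

/-- The kernel `(y-x)⁻²` is integrable on a rectangle `(a,b) × (c,d)` with `b < c`. [folklore] -/
theorem integrableOn_inv_sq_prod {a b c d : ℝ} (hbc : b < c) :
    IntegrableOn (fun p : ℝ × ℝ => ((p.2 - p.1) ^ 2)⁻¹) (Ioo a b ×ˢ Ioo c d) := by
  refine IntegrableOn.of_bound ?_ ?_ (((c - b) ^ 2)⁻¹) ?_
  · rw [Measure.volume_eq_prod, Measure.prod_prod, Real.volume_Ioo, Real.volume_Ioo]
    exact ENNReal.mul_lt_top ENNReal.ofReal_lt_top ENNReal.ofReal_lt_top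
  · exact (((measurable_snd.sub measurable_fst).pow_const 2).inv).aestronglyMeasurable
  · rw [ae_restrict_iff' (measurableSet_Ioo.prod measurableSet_Ioo)]
    refine Eventually.of_forall fun p hp => ?_
    obtain ⟨⟨-, h1⟩, h2, -⟩ := hp
    have h0 : 0 < c - b := by linarith
    have h3 : c - b ≤ p.2 - p.1 := by linarith
    rw [Real.norm_eq_abs, abs_of_nonneg (by positivity)]
    exact inv_anti₀ (by positivity) (pow_le_pow_left₀ h0.le h3 2)

/-- Same with the roles of the coordinates exchanged: `(a,b) × (c,d)` with `d < a`. [folklore] -/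
theorem integrableOn_inv_sq_prod' {a b c d : ℝ} (hda : d < a) :
    IntegrableOn (fun p : ℝ × ℝ => ((p.2 - p.1) ^ 2)⁻¹) (Ioo a b ×ˢ Ioo c d) := by
  refine IntegrableOn.of_bound ?_ ?_ (((a - d) ^ 2)⁻¹) ?_
  · rw [Measure.volume_eq_prod, Measure.prod_prod, Real.volume_Ioo, Real.volume_Ioo]
    exact ENNReal.mul_lt_top ENNReal.ofReal_lt_top ENNReal.ofReal_lt_top
  · exact (((measurable_snd.sub measurable_fst).pow_const 2).inv).aestronglyMeasurable
  · rw [ae_restrict_iff' (measurableSet_Ioo.prod measurableSet_Ioo)]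
    refine Eventually.of_forall fun p hp => ?_
    obtain ⟨⟨h1, -⟩, -, h2⟩ := hp
    have h0 : 0 < a - d := by linarith
    have h3 : a - d ≤ p.1 - p.2 := by linarith
    rw [Real.norm_eq_abs, abs_of_nonneg (by positivity), show (p.2 - p.1) ^ 2 = (p.1 - p.2) ^ 2 by ring]
    exact inv_anti₀ (by positivity) (pow_le_pow_left₀ h0.le h3 2)

/-- `∫_{(-R,m)×(M,R)} dxdy/(y-x)² = log((M+R)/(M-m)) - log(2R/(R-m))`. [folklore] -/
theorem setIntegral_inv_sq_rect {m M R : ℝ} (hRm : -R < m) (hmM : m < M) (hMR : M < R) :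
    ∫ p in Ioo (-R) m ×ˢ Ioo M R, ((p.2 - p.1) ^ 2)⁻¹ =
      Real.log ((M + R) / (M - m)) - Real.log ((R + R) / (R - m)) := by
  rw [Measure.volume_eq_prod, setIntegral_prod _ (by
    rw [← Measure.volume_eq_prod]; exact integrableOn_inv_sq_prod hmM)]
  have h1 : ∀ x ∈ Ioo (-R) m, ∫ y in Ioo M R, (fun p : ℝ × ℝ => ((p.2 - p.1) ^ 2)⁻¹) (x, y) =
      (M - x)⁻¹ - (R - x)⁻¹ := by
    intro x hx
    show ∫ y in Ioo M R, ((y - x) ^ 2)⁻¹ = _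
    rw [← integral_Ioc_eq_integral_Ioo, ← intervalIntegral.integral_of_le hMR.le]
    exact integral_inv_sq_sub (by linarith [hx.2]) hMR.le
  rw [setIntegral_congr_fun measurableSet_Ioo h1, ← integral_Ioc_eq_integral_Ioo,
    ← intervalIntegral.integral_of_le hRm.le]
  exact integral_inv_sub_inv hRm.le hmM hMR

/-- `∫_{(M,R)×(-R,m)} dxdy/(y-x)² = log((R-m)/(M-m)) - log(2R/(M+R))`. [folklore] -/
theorem setIntegral_inv_sq_rect' {m M R : ℝ} (hRm : -R < m) (hmM : m < M) (hMR : M < R) :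
    ∫ p in Ioo M R ×ˢ Ioo (-R) m, ((p.2 - p.1) ^ 2)⁻¹ =
      Real.log ((R - m) / (M - m)) - Real.log ((R + R) / (M + R)) := by
  rw [Measure.volume_eq_prod, setIntegral_prod _ (by
    rw [← Measure.volume_eq_prod]; exact integrableOn_inv_sq_prod' hmM)]
  have h1 : ∀ x ∈ Ioo M R, ∫ y in Ioo (-R) m, (fun p : ℝ × ℝ => ((p.2 - p.1) ^ 2)⁻¹) (x, y) =
      (x - m)⁻¹ - (x + R)⁻¹ := by
    intro x hx
    show ∫ y in Ioo (-R) m, ((y - x) ^ 2)⁻¹ = _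
    rw [← integral_Ioc_eq_integral_Ioo, ← intervalIntegral.integral_of_le hRm.le]
    exact integral_inv_sq_sub' hRm.le (by linarith [hx.1])
  rw [setIntegral_congr_fun measurableSet_Ioo h1, ← integral_Ioc_eq_integral_Ioo,
    ← intervalIntegral.integral_of_le hMR.le]
  exact integral_inv_sub_inv' (by linarith) hmM hMR.le

/-- **The weight in closed form**: for `m = min s t < M = max s t` with `-R < m`, `M < R`,
`w_R(s,t) = 2 (log (M + R) + log (R - m) - log (2R) - log (M - m))`. [folklore] -/
theorem quadW_eq {R : ℝ} {q : ℝ × ℝ} (hm : -R < min q.1 q.2) (hM : max q.1 q.2 < R)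
    (hne : min q.1 q.2 < max q.1 q.2) :
    quadW R q = 2 * (Real.log (max q.1 q.2 + R) + Real.log (R - min q.1 q.2) - Real.log (R + R) -
      Real.log (max q.1 q.2 - min q.1 q.2)) := by
  set m := min q.1 q.2 with hm'
  set M := max q.1 q.2 with hM'
  have hdisj : Disjoint (Ioo (-R) m ×ˢ Ioo M R) (Ioo M R ×ˢ Ioo (-R) m) := by
    rw [Set.disjoint_left]
    rintro ⟨x, y⟩ ⟨⟨-, hx⟩, -, -⟩ ⟨⟨hx', -⟩, -, -⟩
    linarith
  rw [quadW, MeasureTheory.integral_indicator (measurableSet_quadV R q), quadV_eq_union R q,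
    setIntegral_union hdisj (measurableSet_Ioo.prod measurableSet_Ioo)
      (integrableOn_inv_sq_prod hne) (integrableOn_inv_sq_prod' hne),
    setIntegral_inv_sq_rect hm hne hM, setIntegral_inv_sq_rect' hm hne hM]
  have h1 : 0 < M - m := by linarith
  have h2 : 0 < M + R := by linarith
  have h3 : 0 < R - m := by linarith
  have h4 : 0 < R + R := by linarith
  rw [Real.log_div h2.ne' h1.ne', Real.log_div h4.ne' h3.ne', Real.log_div h3.ne' h1.ne',
    Real.log_div h4.ne' h2.ne']
  ring



end LogEnergy

end Literature.Analysis.Potential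

end
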